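import Summits.NavierStokesRegularity.NavierStokesRegularity.Theorems.SqueezeCycleExtremalBiaxialitySubcriticalReductions
import Summits.NavierStokesRegularity.NavierStokesRegularity.Theorems.SqueezeCycleMustSqueezeSimDictionary
import Summits.NavierStokesRegularity.NavierStokesRegularity.Theorems.SqueezeCycleMustSqueezeEndgame
import Summits.NavierStokesRegularity.NavierStokesRegularity.Theorems.SqueezeCycleMustSqueezeGradEnergyBasic
import Summits.NavierStokesRegularity.NavierStokesRegularity.Theorems.SqueezeCycleMustSqueezeGradEnergyAverage
import Summits.NavierStokesRegularity.NavierStokesRegularity.Theorems.SqueezeCycleMustSqueezeDivCurlBalls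
import Summits.NavierStokesRegularity.NavierStokesRegularity.Theorems.SqueezeCycleMustSqueezeTwoPassGronwall
import Summits.NavierStokesRegularity.NavierStokesRegularity.Theorems.SqueezeCycleMustSqueezeSignedBudget
import Literature.Analysis.FluidPDE.LerayGaugeStrainSpectrum
import Mathlib.Analysis.SpecialFunctions.SmoothTransition
import HarnessLib

/-!
# Route `SqueezeCycle`, crux `ExtremalBiaxialitySubcritical` — the `MustSqueeze` family below `1/4` and the unconditional quarter bootstrap (line `quarter-bootstrap-pinning`)

Helper file for item `stmt-NavierStokesRegularity-11609`
(`Summit.NavierStokesRegularity.NavierStokesRegularity.Theses.SqueezeCycle.ExtremalBiaxialitySubcritical`),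
registered sub-goals `mustSqueeze_family` and `extremalBiaxialitySubcritical_of_noMarginalExtremal` of
line `quarter-bootstrap-pinning`.

* `mustSqueeze_family` — **the `MustSqueeze` family**: for every threshold `a < 1/4`, an element of the
  route class `𝒦_C` (inline: joint smoothness on the open past, `div u = 0`, the KNSS-mild Oseen
  identity, the Type-I rate `HasTypeITimeDecay C u`, the scaled local energies) whose Leray-gauge middle
  strain eigenvalue is `≤ a` at every point (Courant–Fischer form: the quadratic form of `(−t)∇u(t,x)`
  is `≤ a|·|²` on some orthonormal two-frame) vanishes identically on the past.  This is the sibling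
  crux `MustSqueeze` (stmt-NavierStokesRegularity-11610, threshold `1/8`) with `1/8` replaced by any
  `a < 1/4`, and it is literally hypothesis (i) `hMS` of the landed quarter bootstrap
  `extremalBiaxialitySubcritical_bootstrap`.  Proof: the composition `MustSqueeze_of` of line
  `outward-drift-signed-flux` of the sibling crux, re-run at the general threshold `a' = max a 0`
  (`0 ≤ a' < 1/4`) over its seven landed stubs `stub_simDictionary`, `stub_endgame`,
  `stub_gradEnergyBasic`, `stub_gradEnergyAverage`, `stub_divCurlBalls`, `stub_signedBudget`,
  `stub_twoPassGronwall` — all of which are stated for a general threshold with rate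
  `c = 2(1/4 − a') > 0`.
* `extremalBiaxialitySubcritical_of_noMarginalExtremal` — **the unconditional quarter bootstrap**: the
  crux follows from `NoMarginalExtremal` alone ("an attained class-wide maximum `m` of the middle
  eigenvalue is `< 1/4`"), by `extremalBiaxialitySubcritical_bootstrap` fed with `mustSqueeze_family`.
  With the trivial converse `noMarginalExtremal_of_extremalBiaxialitySubcritical` the crux is now
  EQUIVALENT to `NoMarginalExtremal`: its whole content sits at attained maxima `m ≥ 1/4`.
-/

noncomputable section

open MeasureTheory Set Filter Topology
open scoped RealInnerProductSpace

namespace Summit.NavierStokesRegularity.NavierStokesRegularity.Theorems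

open Literature.Analysis.FluidPDE
open Summit.NavierStokesRegularity.NavierStokesRegularity.Theses.SqueezeCycle

/-- **The `MustSqueeze` family below `1/4`** (line `quarter-bootstrap-pinning`, registered sub-goal;
hypothesis (i) of `extremalBiaxialitySubcritical_bootstrap`): for every `a < 1/4`, an element of `𝒦_C`
whose Leray-gauge middle strain eigenvalue is `≤ a` everywhere (Courant–Fischer form) vanishes
identically on `t < 0`.  Proof: the inline class is the tree's `IsTypeIAncientMild C u`
(`isTypeIAncientMild_of_squeezeClass`); H6 is `Λ ≤ a ≤ a' := max a 0` (`lerayMiddleStrain_le_iff`);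
the dictionary, comparison and signed-budget stubs of the sibling crux `MustSqueeze` (line
`outward-drift-signed-flux`, all landed, stated for a general threshold `a' ≥ 0`) feed the abstract
two-pass backward Grönwall lemma `stub_twoPassGronwall` with rate `c = 2(1/4 − a') > 0`, which kills
every ball gradient energy of the similarity orbit, and `stub_endgame` returns `u ≡ 0`. [folklore] -/
theorem mustSqueeze_family : ∀ a : ℝ, a < 1 / 4 → ∀ (C : ℝ) (u : ℝ → EuclideanSpace ℝ (Fin 3) → EuclideanSpace ℝ (Fin 3)), ContDiffOn ℝ (⊤ : ℕ∞) (Function.uncurry u) (Set.Iio 0 ×ˢ Set.univ) ∧ (∀ t < 0, Literature.Analysis.FluidPDE.VectorCalculus.IsDivFree (u t)) ∧ (∀ s t : ℝ, s < t → t < 0 → ∀ x, u t x = Literature.Analysis.FluidPDE.heatFlow (u s) (t-s) x - ∫ τ in Set.Ioo s t, ∫ y, ((-(inner ℝ (x-y) (u τ y) / (2*(t-τ)) * Literature.Analysis.UnboundedOperators.heatKernel (t-τ) (x-y))) • u τ y + (∫ σ in Set.Ioi (t-τ), Literature.Analysis.UnboundedOperators.heatKernel σ (x-y) / (4*σ^2))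 • (inner ℝ (x-y) (u τ y) • u τ y + inner ℝ (u τ y) (u τ y) • (x-y) + inner ℝ (x-y) (u τ y) • u τ y) - ((∫ σ in Set.Ioi (t-τ), Literature.Analysis.UnboundedOperators.heatKernel σ (x-y) / (8*σ^3)) * (inner ℝ (x-y) (u τ y) * inner ℝ (x-y) (u τ y))) • (x-y))) ∧ Literature.Analysis.FluidPDE.HasTypeITimeDecay C u ∧ (∀ (x₀ : EuclideanSpace ℝ (Fin 3)) (t₀ r : ℝ), t₀ ≤ 0 → 0 < r → (∀ t, t₀ - r^2 < t → t < t₀ → r⁻¹ * ∫ x in Metric.ball x₀ r, ‖u t x‖^2 ≤ C) ∧ r⁻¹ * ∫ t in Set.Ioo (t₀ - r^2) t₀, ∫ x in Metric.ball x₀ r, ‖fderiv ℝ (u t) x‖^2 ≤ C) → (∀ t < 0, ∀ x, (∃ v w : EuclideanSpace ℝ (Fin 3), ‖v‖ = 1 ∧ ‖w‖ = 1 ∧ inner ℝ v w = 0 ∧ ∀ α β : ℝ, (-t) * inner ℝ (fderiv ℝ (u t) x (α • v + β • w)) (α • v + β • w) ≤ a * (α^2 + β^2))) → ∀ t < 0,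 ∀ x, u t x = 0 := by
  intro a ha C u hu h6
  obtain ⟨h1, h2, h3, h4, h5⟩ := hu
  -- the inline class is the tree's Type-I KNSS-mild class
  have hK : IsTypeIAncientMild C u := isTypeIAncientMild_of_squeezeClass h1 h2 h3 h4
  -- the nonnegative threshold `a' = max a 0`, still `< 1/4`
  have ha' : (0 : ℝ) ≤ max a 0 := le_max_right a 0
  have ha4 : max a 0 < 1 / 4 := max_lt ha (by norm_num)
  -- H6 is `Λ ≤ a ≤ a'` (Courant–Fischer)
  have hΛ : ∀ t < 0, ∀ x, lerayMiddleStrain u t x ≤ max a 0 := fun t ht x =>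
    ((lerayMiddleStrain_le_iff ht a).2 (h6 t ht x)).trans (le_max_left a 0)
  -- the landed stubs of line outward-drift-signed-flux (crux MustSqueeze)
  obtain ⟨hUle, hMorrey⟩ := stub_simDictionary C u hK h5
  obtain ⟨hE0, hEcont, hEmono⟩ := stub_gradEnergyBasic C u hK
  have hEavg := stub_gradEnergyAverage C u hK h5 hEcont
  obtain ⟨κ', hdc⟩ := stub_divCurlBalls C u hK hMorrey
  obtain ⟨κ, hbudget⟩ := stub_signedBudget C (max a 0) κ' u hK hΛ ha' hUle hEcont
    (fun R s hR => (hdc R s hR).2.1)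
  -- abstract two-pass Grönwall
  set Z : ℝ → ℝ → ℝ := fun R s =>
    ∫ y, Real.smoothTransition (2 - ‖y‖ ^ 2 / R ^ 2) * ‖lerayVorticity u s y‖ ^ 2 with hZ
  set E : ℝ → ℝ → ℝ := fun ρ s =>
    ∫ y in Metric.ball (0 : EuclideanSpace ℝ (Fin 3)) ρ,
      frobeniusNormSq (fderiv ℝ (lerayOrbit u s) y) with hE
  have hc : (0 : ℝ) < 2 * (1 / 4 - max a 0) := by linarith
  have hZ0 : ∀ R s : ℝ, 1 ≤ R → 0 ≤ Z R s := fun R s _ =>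
    integral_nonneg fun y => mul_nonneg (Real.smoothTransition.nonneg _) (sq_nonneg _)
  have hbudget' : ∀ R : ℝ, 1 ≤ R → Differentiable ℝ (Z R) ∧ ∃ K : ℝ → ℝ, Continuous K ∧
      (∀ s, 0 ≤ K s) ∧ (∀ s, K s ≤ κ * (E (2 * R) s / R + Real.sqrt (E (2 * R) s / R))) ∧
      ∀ s, deriv (Z R) s ≤ -(2 * (1 / 4 - max a 0)) * Z R s + K s := fun R hR => hbudget R hR
  have hvan : ∀ ρ s : ℝ, 0 < ρ → E ρ s = 0 :=
    stub_twoPassGronwall (2 * (1 / 4 - max a 0)) κ κ' (6 * C) Z E hc hE0 hEcont hEmono hEavg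
      hbudget' hZ0 (fun R R' s hR hRR' => (hdc R s hR).2.2.2 R' hRR') (fun R s hR => (hdc R s hR).1)
      (fun R s hR => ((hdc R s hR).2.2.1).trans ((hdc R s hR).2.1))
  exact stub_endgame C u hK hMorrey hvan

/-- **The unconditional quarter bootstrap** (line `quarter-bootstrap-pinning`, registered sub-goal):
the crux `ExtremalBiaxialitySubcritical` follows from `NoMarginalExtremal` — "an attained class-wide
maximum `m` of the Leray-gauge middle strain eigenvalue over `𝒦_C` is `< 1/4`" (the crux with its
conclusion `m < 1/8` weakened to `m < 1/4`).  Proof: `extremalBiaxialitySubcritical_bootstrap` with its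
hypothesis (i) discharged by `mustSqueeze_family`.  Together with the trivial converse
`noMarginalExtremal_of_extremalBiaxialitySubcritical`, the crux is equivalent to `NoMarginalExtremal`.
[folklore] -/
theorem extremalBiaxialitySubcritical_of_noMarginalExtremal : (∀ (C m : ℝ) (u : ℝ → EuclideanSpace ℝ (Fin 3) → EuclideanSpace ℝ (Fin 3)) (t₀ : ℝ) (x₀ : EuclideanSpace ℝ (Fin 3)), t₀ < 0 → (ContDiffOn ℝ (⊤ : ℕ∞) (Function.uncurry u) (Set.Iio 0 ×ˢ Set.univ) ∧ (∀ t < 0, Literature.Analysis.FluidPDE.VectorCalculus.IsDivFree (u t)) ∧ (∀ s t : ℝ, s < t → t < 0 → ∀ x, u t x = Literature.Analysis.FluidPDE.heatFlow (u s) (t-s) x - ∫ τ in Set.Ioo s t, ∫ y, ((-(inner ℝ (x-y) (u τ y) / (2*(t-τ)) * Literature.Analysis.UnboundedOperators.heatKernel (t-τ) (x-y))) • u τ y + (∫ σ in Set.Ioi (t-τ), Literature.Analysis.UnboundedOperators.heatKernel σ (x-y) / (4*σ^2)) • (inner ℝ (x-y) (u τ y) • u τ y + inner ℝ (u τ y)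 (u τ y) • (x-y) + inner ℝ (x-y) (u τ y) • u τ y) - ((∫ σ in Set.Ioi (t-τ), Literature.Analysis.UnboundedOperators.heatKernel σ (x-y) / (8*σ^3)) * (inner ℝ (x-y) (u τ y) * inner ℝ (x-y) (u τ y))) • (x-y))) ∧ Literature.Analysis.FluidPDE.HasTypeITimeDecay C u ∧ (∀ (x₀ : EuclideanSpace ℝ (Fin 3)) (t₀ r : ℝ), t₀ ≤ 0 → 0 < r → (∀ t, t₀ - r^2 < t → t < t₀ → r⁻¹ * ∫ x in Metric.ball x₀ r, ‖u t x‖^2 ≤ C) ∧ r⁻¹ * ∫ t in Set.Ioo (t₀ - r^2) t₀, ∫ x in Metric.ball x₀ r, ‖fderiv ℝ (u t) x‖^2 ≤ C)) → (∃ v w : EuclideanSpace ℝ (Fin 3), ‖v‖ = 1 ∧ ‖w‖ = 1 ∧ inner ℝ v w = 0 ∧ ∀ α β : ℝ, m * (α^2 + β^2) ≤ (-t₀) * inner ℝ (fderiv ℝ (u t₀) x₀ (α • v + β • w)) (α • v + β • w)) → (∀ v' : ℝ → EuclideanSpace ℝ (Fin 3) → EuclideanSpace ℝ (Fin 3), ContDiffOn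 ℝ (⊤ : ℕ∞) (Function.uncurry v') (Set.Iio 0 ×ˢ Set.univ) ∧ (∀ t < 0, Literature.Analysis.FluidPDE.VectorCalculus.IsDivFree (v' t)) ∧ (∀ s t : ℝ, s < t → t < 0 → ∀ x, v' t x = Literature.Analysis.FluidPDE.heatFlow (v' s) (t-s) x - ∫ τ in Set.Ioo s t, ∫ y, ((-(inner ℝ (x-y) (v' τ y) / (2*(t-τ)) * Literature.Analysis.UnboundedOperators.heatKernel (t-τ) (x-y))) • v' τ y + (∫ σ in Set.Ioi (t-τ), Literature.Analysis.UnboundedOperators.heatKernel σ (x-y) / (4*σ^2)) • (inner ℝ (x-y) (v' τ y) • v' τ y + inner ℝ (v' τ y) (v' τ y) • (x-y) + inner ℝ (x-y) (v' τ y) • v' τ y) - ((∫ σ in Set.Ioi (t-τ), Literature.Analysis.UnboundedOperators.heatKernel σ (x-y) / (8*σ^3)) * (inner ℝ (x-y) (v' τ y) * inner ℝ (x-y) (v' τ y))) • (x-y))) ∧ Literature.Analysis.FluidPDE.HasTypeITimeDecay C v' ∧ (∀ (x₀ : EuclideanSpace ℝ (Fin 3)) (t₀ r : ℝ), t₀ ≤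 0 → 0 < r → (∀ t, t₀ - r^2 < t → t < t₀ → r⁻¹ * ∫ x in Metric.ball x₀ r, ‖v' t x‖^2 ≤ C) ∧ r⁻¹ * ∫ t in Set.Ioo (t₀ - r^2) t₀, ∫ x in Metric.ball x₀ r, ‖fderiv ℝ (v' t) x‖^2 ≤ C) → ∀ t < 0, ∀ x, (∃ v w : EuclideanSpace ℝ (Fin 3), ‖v‖ = 1 ∧ ‖w‖ = 1 ∧ inner ℝ v w = 0 ∧ ∀ α β : ℝ, (-t) * inner ℝ (fderiv ℝ (v' t) x (α • v + β • w)) (α • v + β • w) ≤ m * (α^2 + β^2))) → m < 1 / 4) → Summit.NavierStokesRegularity.NavierStokesRegularity.Theses.SqueezeCycle.ExtremalBiaxialitySubcritical :=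
  fun hNM => extremalBiaxialitySubcritical_bootstrap mustSqueeze_family hNM

end Summit.NavierStokesRegularity.NavierStokesRegularity.Theorems

end
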